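import Mathlib.Probability.Distributions.Uniform
import Literature.Computability.Cryptography.DihedralCosetProblemProofs
import Literature.Computability.QuantumComplexity.BlockBranches
import HarnessLib

/-!
# The coset-state mixture behind a block: consuming a DCP solver's promise branch by branch

Infrastructure (trunk `CryptoQuantFine` model of `QuantumCircuit.lean`) towards the discharge of
`Literature.Algebra.EuclideanLattices.usvp_of_dihedralCoset` (O. Regev, *Quantum computation and
lattice problems*, SIAM J. Comput. 33 (2004), Thm. 1.1), continuing `BlockBranches.lean`.

In the proof of Regev's Lemma 3.12 (p. 14) the registers handed to the dihedral-coset solver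
arise from *measuring* one register of each of `r` copies of a uniform superposition: conditioned
on the measured values, register `k` is left in a coset state `(|0,x⟩ + |1,(x+d) mod N⟩)/√2`
("good") or in a basis state `|b,x⟩` ("bad"), and the solver's promise — in the tree,
`DCP.HasSolution`: success probability `≥ 1/poly` on every *admissible* law of register contents,
`DCP.IsAdmissible` — is applied to the law of the contents. In the tree's measurement-free model
the state before the solver is `α ∑_{c} |emb c⟩`, a uniform superposition over an injectively
labelled family of basis states (the "coins" `c`), conditioning is the branch decomposition of
`BlockBranches.sum_ite_normSq_placeGate_eq_sum_probEvent`, and this file turns a combinatorial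
description of the branches into the solver's input format:

* `RegRel`, `DcpSet m N r d ρ` — the support of the input state `DCP.inputState m N r d ρ`
  (prefix `encodeNat N`, register `k` in the relation of `ρ k`, zero tail), with
  **`inputState_apply`**: `inputState … ρ = (1/√2)^{#good ρ} · 1_{DcpSet ρ}` and
  `card_dcpSet : |DcpSet ρ| = 2^{#good ρ}` (read off `DCP.normSq_inputState_holds`);
* **`bornSum_eq_mul_sum_probEvent`** — if the event asks `Toff` off the block and the solver's
  success event on it, and for every coin `c` meeting `Toff` the block contents of the coins with
  the same off-block content as `c` are *exactly* the support `DcpSet (ρf c)` (three hypotheses: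
  `ρf` constant on these fibres, fibre ⊆ support, support ⊆ fibre), then the Born weight of the
  event is `‖α‖² ∑_{c : Toff} probEvent C (inputState (ρf c)) success`;
* `successProb_map_uniformOfFinset`, `isAdmissible_map_uniformOfFinset` — that sum is
  `#{c : Toff} · successProb C N d μ` for the law `μ` of `ρf c`, `c` uniform among the coins
  meeting `Toff`, and `μ` is admissible as soon as, for each `k`, register `k` is good for all but
  a fraction `1/(log₂ N)^f` of those coins;
* **`bornSum_ge`** — hence a solver succeeding with probability `≥ q` on admissible laws gives the
  event Born weight `≥ ‖α‖² · #{c : Toff} · q`.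

No named fact is introduced.

## References

* O. Regev, *Quantum computation and lattice problems*, SIAM J. Comput. 33 (2004) 738–760,
  Def. 2.1 (registers, good and bad) and proof of Lemma 3.12 (p. 14) [Regev2004].
* M. A. Nielsen, I. L. Chuang, *Quantum Computation and Quantum Information*, CUP 2010, §2.2.5
  (Born rule), §4.4 (principle of deferred measurement) [NielsenChuang2010].
-/

noncomputable section

namespace Literature.Computability.QuantumComplexity

open _root_.Computability Cryptography Cryptography.DCP Matrix Finset

namespace DCPMixture

variable {G : QGateSet} {m W : ℕ}

/-! ### The support of the input state -/

/-- The register relation of the content `ρ` with shift `d`: the basis states `|c, y⟩` carrying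
amplitude — `|b, x⟩` for a bad register `(some b, x)`; `|0, x⟩` and `|1, (x + d) mod N⟩` for a
good one `(none, x)`. [cite: Regev2004, Def. 2.1] -/
def RegRel (N d : ℕ) (ρ : Register N) (c : Bool) (y : ℕ) : Prop :=
  (ρ.1 = some c ∧ y = (ρ.2 : ℕ)) ∨ (ρ.1 = none ∧ ((c = false ∧ y = (ρ.2 : ℕ)) ∨ (c = true ∧ y = ((ρ.2 : ℕ) + d) % N)))

/-- The register relation is decidable. [folklore] -/
instance instDecidableRegRel (N d : ℕ) (ρ : Register N) (c : Bool) (y : ℕ) : Decidable (RegRel N d ρ c y) := by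
  unfold RegRel; infer_instance

/-- The register amplitude is `1` (bad register) or `1/√2` (good register) on the register
relation and `0` off it. [cite: Regev2004, Def. 2.1] -/
theorem registerAmp_eq (N d : ℕ) (ρ : Register N) (c : Bool) (y : ℕ) :
    registerAmp N d ρ c y = if RegRel N d ρ c y then (if ρ.1 = none then ((Real.sqrt 2 : ℂ))⁻¹ else 1) else 0 := by
  rcases ρ with ⟨_ | b, x⟩
  · simp [registerAmp, RegRel]
  · have e : RegRel N d (some b, x) c y ↔ (c = b ∧ y = x.val) := by
      simp only [RegRel, Option.some.injEq, reduceCtorEq, false_and, or_false]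
      exact ⟨fun h => ⟨h.1.symm, h.2⟩, fun h => ⟨h.1.symm, h.2⟩⟩
    simp only [registerAmp, reduceCtorEq, if_false]
    by_cases h : c = b ∧ y = x.val
    · rw [if_pos h, if_pos (e.2 h)]
    · rw [if_neg h, if_neg (fun h' => h (e.1 h'))]

/-- **The support of the input state** of the instance `(N, d)` with `r` registers of contents
`ρ` on `m` wires: prefix `encodeNat N`, register `k` in the relation of `ρ k`, zero tail.
[cite: Regev2004, Def. 2.1] -/
def DcpSet (m N r d : ℕ) (ρ : Fin r → Register N) (u : QReg m) : Prop :=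
  (∀ t : Fin (len N), qbit u t = (encodeNat N).getD t false) ∧
    (∀ k : Fin r, RegRel N d (ρ k) (qbit u (len N + k * (len N + 1))) (readNat u (len N + k * (len N + 1) + 1) (len N))) ∧
    ∀ i : Fin m, len N + r * (len N + 1) ≤ (i : ℕ) → u i = false

/-- The support predicate is decidable. [folklore] -/
instance instDecidablePredDcpSet (m N r d : ℕ) (ρ : Fin r → Register N) : DecidablePred (DcpSet m N r d ρ) := fun u => by
  unfold DcpSet; infer_instance

/-- The number of good (coset) registers of the contents `ρ`. [cite: Regev2004, Def. 2.1] -/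
def numGood {N r : ℕ} (ρ : Fin r → Register N) : ℕ := (univ.filter fun k => (ρ k).1 = none).card

/-- **The input state is `(1/√2)^{#good}` on its support and `0` elsewhere.** [cite: Regev2004, Def. 2.1] -/
theorem inputState_apply (m N r d : ℕ) (ρ : Fin r → Register N) (u : QReg m) :
    inputState m N r d ρ u = if DcpSet m N r d ρ u then (((Real.sqrt 2 : ℂ))⁻¹) ^ numGood ρ else 0 := by
  have hprod : (∏ k : Fin r, registerAmp N d (ρ k) (qbit u (len N + k * (len N + 1))) (readNat u (len N + k * (len N + 1) + 1) (len N))) =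
      if ∀ k : Fin r, RegRel N d (ρ k) (qbit u (len N + k * (len N + 1))) (readNat u (len N + k * (len N + 1) + 1) (len N)) then
        (((Real.sqrt 2 : ℂ))⁻¹) ^ numGood ρ else 0 := by
    simp_rw [registerAmp_eq]
    rw [Fintype.prod_ite_zero]
    congr 1
    rw [Finset.prod_ite, Finset.prod_const_one, mul_one, Finset.prod_const]
    rfl
  unfold inputState
  rw [hprod]
  by_cases hD : DcpSet m N r d ρ u
  · obtain ⟨h1, h2, h3⟩ := hD
    rw [if_pos (show DcpSet m N r d ρ u from ⟨h1, h2, h3⟩), if_pos h1, if_pos h2, if_pos h3, one_mul, mul_one]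
  · rw [if_neg hD]
    by_cases h1 : ∀ t : Fin (len N), qbit u t = (encodeNat N).getD t false
    · by_cases h2 : ∀ k : Fin r, RegRel N d (ρ k) (qbit u (len N + k * (len N + 1))) (readNat u (len N + k * (len N + 1) + 1) (len N))
      · have h3 : ¬ ∀ i : Fin m, len N + r * (len N + 1) ≤ (i : ℕ) → u i = false := fun h3 => hD ⟨h1, h2, h3⟩
        rw [if_neg h3, mul_zero]
      · rw [if_neg h2, mul_zero, zero_mul]
    · rw [if_neg h1, zero_mul, zero_mul]

/-- **The indicator of the support is `(√2)^{#good}` times the input state.** [cite: Regev2004, Def. 2.1] -/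
theorem indicator_dcpSet_eq_smul (m N r d : ℕ) (ρ : Fin r → Register N) :
    (fun u => if DcpSet m N r d ρ u then (1 : ℂ) else 0) = ((Real.sqrt 2 : ℂ) ^ numGood ρ) • inputState m N r d ρ := by
  funext u
  rw [Pi.smul_apply, smul_eq_mul, inputState_apply]
  split_ifs
  · rw [← mul_pow, mul_inv_cancel₀ (by exact_mod_cast (Real.sqrt_pos.2 two_pos).ne' : (Real.sqrt 2 : ℂ) ≠ 0), one_pow]
  · rw [mul_zero]

/-- **The support has `2^{#good}` elements** (on a register wide enough for the prefix and the
`r` registers): the unit-norm statement `DCP.normSq_inputState_holds`, read through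
`inputState_apply`. [cite: Regev2004, Def. 2.1] -/
theorem card_dcpSet {m N r : ℕ} (d : ℕ) (ρ : Fin r → Register N) (hm : len N + r * (len N + 1) ≤ m) :
    (univ.filter (DcpSet m N r d ρ)).card = 2 ^ numGood ρ := by
  have h := normSq_inputState_holds m N r d ρ hm
  simp_rw [inputState_apply] at h
  have h2 : ∑ s : QReg m, (if DcpSet m N r d ρ s then ((1 : ℝ) / 2) ^ numGood ρ else 0) = 1 := by
    refine Eq.trans (sum_congr rfl fun s _ => ?_) h
    split_ifs
    · rw [norm_pow, norm_inv, Complex.norm_real, Real.norm_eq_abs, abs_of_nonneg (Real.sqrt_nonneg _),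
        ← pow_mul, mul_comm, pow_mul, inv_pow, Real.sq_sqrt (by norm_num : (0 : ℝ) ≤ 2), one_div]
    · simp
  rw [← Finset.sum_filter, sum_const, nsmul_eq_mul] at h2
  have h4 : ((1 : ℝ) / 2) ^ numGood ρ * 2 ^ numGood ρ = 1 := by rw [← mul_pow]; norm_num
  have h5 : ((univ.filter (DcpSet m N r d ρ)).card : ℝ) = 2 ^ numGood ρ := by
    calc ((univ.filter (DcpSet m N r d ρ)).card : ℝ)
        = (univ.filter (DcpSet m N r d ρ)).card * (((1 : ℝ) / 2) ^ numGood ρ * 2 ^ numGood ρ) := by rw [h4, mul_one]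
      _ = (univ.filter (DcpSet m N r d ρ)).card * ((1 : ℝ) / 2) ^ numGood ρ * 2 ^ numGood ρ := by ring
      _ = 2 ^ numGood ρ := by rw [h2, one_mul]
  exact_mod_cast h5

/-! ### The success event is decidable -/

/-- Membership in the success event is decidable. [folklore] -/
instance instDecidableMemSuccessEvent (m N d : ℕ) : DecidablePred (· ∈ successEvent m N d) := fun s =>
  decidable_of_iff (∀ t < len N, qbit s t = d.testBit t) Iff.rfl

/-! ### The Born weight of "off-block content in `Toff`, solver succeeds" -/

section Mixture

variable (E : Fin m ↪ Fin W) (C : QCircuit G m) (Ψ : QReg W → ℂ) (α : ℂ) {ι : Type*} [Fintype ι]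
  (emb : ι → QReg W) (Toff : QReg W → Prop) [DecidablePred Toff] {N r : ℕ} (d : ℕ) (ρf : ι → Fin r → Register N)

/-- A register is its block content written into its zero-block representative. [folklore] -/
theorem extend_restrict_zeroBlock (w : QReg W) :
    Function.extend E (w ∘ E) (Function.extend E (fun _ => false) w) = w :=
  (extend_eq_iff E _ _ _).2 ⟨rfl, (agreeOff_extend E _ w).symm⟩

/-- The zero-block representative of `extend E z y`, for `y` with zero block, is `y`. [folklore] -/
theorem zeroBlock_extend {y : QReg W} (hy : ∀ j, y (E j) = false) (z : QReg m) :
    Function.extend E (fun _ => false) (Function.extend E z y) = y := by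
  rw [extend_extend E]
  exact (extend_zero_eq_iff E hy y).2 fun _ _ => rfl

/-- **The Born weight of the event "off-block content in `Toff` and the solver's success event on
the block" behind a uniform superposition of injectively labelled basis states whose fibres over
the off-block content have DCP-shaped block contents** is `‖α‖²` times the sum, over the labels
meeting `Toff`, of the success probabilities of the solver's circuit on the corresponding DCP
input states. [cite: Regev2004, Lemma 3.12 (proof, p. 14: "the state collapses to … (|0,ā⟩ + |1,ā'⟩)/√2 … otherwise a bad register")] -/
theorem bornSum_eq_mul_sum_probEvent (hinj : Function.Injective emb)
    (hΨ : ∀ y, Ψ y = if ∃ c, emb c = y then α else 0) (hm : len N + r * (len N + 1) ≤ m)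
    (hconst : ∀ c c', Toff (Function.extend E (fun _ => false) (emb c)) →
      Function.extend E (fun _ => false) (emb c') = Function.extend E (fun _ => false) (emb c) → ρf c' = ρf c)
    (hmem : ∀ c c', Toff (Function.extend E (fun _ => false) (emb c)) →
      Function.extend E (fun _ => false) (emb c') = Function.extend E (fun _ => false) (emb c) → DcpSet m N r d (ρf c) (emb c' ∘ E))
    (hsurj : ∀ c u, Toff (Function.extend E (fun _ => false) (emb c)) → DcpSet m N r d (ρf c) u →
      ∃ c', Function.extend E (fun _ => false) (emb c') = Function.extend E (fun _ => false) (emb c) ∧ emb c' ∘ E = u) :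
    (∑ z : QReg W, if Toff (Function.extend E (fun _ => false) z) ∧ z ∘ E ∈ successEvent m N d then
        ‖(placeGate E (C.toMatrix 0) *ᵥ Ψ) z‖ ^ 2 else 0) =
      ‖α‖ ^ 2 * ∑ c ∈ univ.filter (fun c => Toff (Function.extend E (fun _ => false) (emb c))),
        C.probEvent 0 (inputState m N r d (ρf c)) (successEvent m N d) := by
  classical
  rw [sum_ite_normSq_placeGate_eq_sum_probEvent 0 E C Ψ Toff (· ∈ successEvent m N d)]
  rw [← Finset.sum_fiberwise_of_maps_to (s := univ.filter (fun c => Toff (Function.extend E (fun _ => false) (emb c))))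
    (t := (univ : Finset (QReg W))) (g := fun c => Function.extend E (fun _ => false) (emb c)) (fun _ _ => mem_univ _)]
  rw [Finset.mul_sum]
  refine sum_congr rfl fun y _ => ?_
  have hS : {u : QReg m | u ∈ successEvent m N d} = successEvent m N d := rfl
  rw [hS]
  by_cases hex : ∃ c, Function.extend E (fun _ => false) (emb c) = y ∧ Toff (Function.extend E (fun _ => false) (emb c))
  · obtain ⟨c, hcy, hT⟩ := hex
    have hy0 : ∀ j, y (E j) = false := fun j => by rw [← hcy]; exact extend_zero_apply_emb E _ j
    have hTy : Toff y := hcy ▸ hT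
    rw [if_pos ⟨hy0, hTy⟩]
    -- the branch is `α (√2)^{#good}` times the input state of `ρf c`
    have hψ : (fun z => Ψ (Function.extend E z y)) = (α * (Real.sqrt 2 : ℂ) ^ numGood (ρf c)) • inputState m N r d (ρf c) := by
      rw [mul_smul, ← indicator_dcpSet_eq_smul]
      funext z
      rw [Pi.smul_apply, smul_eq_mul, hΨ, mul_ite, mul_one, mul_zero]
      refine if_congr ⟨?_, fun hz => ?_⟩ rfl rfl
      · rintro ⟨c', hc'⟩
        have h1 : Function.extend E (fun _ => false) (emb c') = Function.extend E (fun _ => false) (emb c) := by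
          rw [hc', zeroBlock_extend E hy0, hcy]
        have h2 : emb c' ∘ E = z := by rw [hc', extend_comp_embedding]
        exact h2 ▸ hmem c c' hT h1
      · obtain ⟨c', h1, h2⟩ := hsurj c z hT hz
        refine ⟨c', ?_⟩
        rw [← extend_restrict_zeroBlock E (emb c'), h2, h1, hcy]
    rw [hψ, probEvent_smul, norm_mul, mul_pow, norm_pow, Complex.norm_real, Real.norm_eq_abs, abs_of_nonneg (Real.sqrt_nonneg _),
      ← pow_mul, mul_comm (numGood (ρf c)) 2, pow_mul, Real.sq_sqrt (by norm_num : (0 : ℝ) ≤ 2)]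
    -- the fibre sum: all terms equal, `2^{#good}` of them
    have hfib : ∀ c' ∈ (univ.filter (fun c => Toff (Function.extend E (fun _ => false) (emb c)))).filter
        (fun c' => Function.extend E (fun _ => false) (emb c') = y), ρf c' = ρf c := fun c' hc' => by
      rw [mem_filter] at hc'
      exact hconst c c' hT (hc'.2.trans hcy.symm)
    rw [sum_congr rfl (g := fun _ => C.probEvent 0 (inputState m N r d (ρf c)) (successEvent m N d))
      (fun c' hc' => by rw [hfib c' hc']), sum_const, nsmul_eq_mul]
    have hcard : ((univ.filter (fun c => Toff (Function.extend E (fun _ => false) (emb c)))).filter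
        (fun c' => Function.extend E (fun _ => false) (emb c') = y)).card = 2 ^ numGood (ρf c) := by
      rw [← card_dcpSet d (ρf c) hm]
      refine card_bij (fun c' _ => emb c' ∘ E) (fun c' hc' => ?_) (fun c₁ h₁ c₂ h₂ h => ?_) (fun u hu => ?_)
      · rw [mem_filter, mem_filter] at hc'
        exact mem_filter.2 ⟨mem_univ _, hmem c c' hT (hc'.2.trans hcy.symm)⟩
      · rw [mem_filter, mem_filter] at h₁ h₂
        apply hinj
        rw [← extend_restrict_zeroBlock E (emb c₁), ← extend_restrict_zeroBlock E (emb c₂), h, h₁.2, h₂.2]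
      · obtain ⟨c', h1, h2⟩ := hsurj c u hT (mem_filter.1 hu).2
        exact ⟨c', mem_filter.2 ⟨mem_filter.2 ⟨mem_univ _, by rw [h1]; exact hT⟩, h1.trans hcy⟩, h2⟩
    rw [hcard]
    push_cast
    ring
  · -- no label has off-block content `y` within `Toff`: both sides vanish
    have hsum : ∑ c' ∈ (univ.filter (fun c => Toff (Function.extend E (fun _ => false) (emb c)))).filter
        (fun c' => Function.extend E (fun _ => false) (emb c') = y),
        C.probEvent 0 (inputState m N r d (ρf c')) (successEvent m N d) = 0 := by
      refine sum_eq_zero fun c' hc' => ?_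
      rw [mem_filter, mem_filter] at hc'
      exact absurd ⟨c', hc'.2, hc'.1.2⟩ hex
    rw [hsum, mul_zero]
    split_ifs with hy
    · have hψ : (fun z => Ψ (Function.extend E z y)) = (0 : ℂ) • (fun z => Ψ (Function.extend E z y)) := by
        rw [zero_smul]
        funext z
        rw [Pi.zero_apply, hΨ, if_neg]
        rintro ⟨c', hc'⟩
        refine hex ⟨c', ?_, ?_⟩
        · rw [hc', zeroBlock_extend E hy.1]
        · rw [hc', zeroBlock_extend E hy.1]; exact hy.2
      rw [hψ, probEvent_smul, norm_zero, zero_pow two_ne_zero, zero_mul]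
    · rfl

/-! ### The law of the register contents -/

/-- Averages against the push-forward of a law on a finite type. [folklore] -/
theorem sum_toReal_map_mul {β : Type*} [Fintype β] (p : PMF ι) (f : ι → β) (g : β → ℝ) :
    ∑ b, (p.map f b).toReal * g b = ∑ a, (p a).toReal * g (f a) := by
  classical
  have h1 : ∀ b, p.map f b = ∑ a, if b = f a then p a else 0 := fun b => by
    rw [PMF.map_apply, tsum_fintype]
  simp_rw [h1]
  have h2 : ∀ b, (∑ a, if b = f a then p a else 0).toReal * g b = ∑ a, if b = f a then (p a).toReal * g b else 0 := fun b => by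
    rw [ENNReal.toReal_sum (fun a _ => ?_), Finset.sum_mul]
    · refine sum_congr rfl fun a _ => ?_
      split_ifs <;> simp
    · split_ifs
      · exact PMF.apply_ne_top p a
      · exact ENNReal.zero_ne_top
  simp_rw [h2]
  rw [Finset.sum_comm]
  refine sum_congr rfl fun a _ => ?_
  rw [Finset.sum_ite_eq']
  simp

/-- **The success probability on the law of `ρf c`, `c` uniform on `S`**, is the average over `S`.
[cite: Regev2004, Def. 2.1] -/
theorem successProb_map_uniformOfFinset (S : Finset ι) (hS : S.Nonempty) :
    successProb C N d ((PMF.uniformOfFinset S hS).map ρf) =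
      (∑ c ∈ S, C.probEvent 0 (inputState m N r d (ρf c)) (successEvent m N d)) / S.card := by
  classical
  unfold successProb
  rw [sum_toReal_map_mul, Finset.sum_div, ← Finset.sum_filter_add_sum_filter_not univ (· ∈ S)]
  rw [show univ.filter (· ∈ S) = S from by ext; simp]
  rw [sum_eq_zero (s := univ.filter fun c => c ∉ S) (fun c hc => by
    rw [PMF.uniformOfFinset_apply_of_notMem hS (mem_filter.1 hc).2]; simp), add_zero]
  refine sum_congr rfl fun c hc => ?_
  rw [PMF.uniformOfFinset_apply_of_mem hS hc, ENNReal.toReal_inv, ENNReal.toReal_natCast]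
  ring

omit [Fintype ι] in
/-- **Admissibility of the law of `ρf c`, `c` uniform on `S`**: it suffices that, for each `k`,
register `k` is good for at least a fraction `1 − 1/(log₂ N)^f` of `S`.
[cite: Regev2004, Def. 2.1 (failure parameter)] -/
theorem isAdmissible_map_uniformOfFinset (f : ℝ) (S : Finset ι) (hS : S.Nonempty)
    (h : ∀ k : Fin r, (1 - 1 / Real.logb 2 N ^ f) * S.card ≤ ((S.filter fun c => (ρf c k).1 = none).card : ℝ)) :
    IsAdmissible f N ((PMF.uniformOfFinset S hS).map ρf) := by
  classical
  intro k
  rw [PMF.toOuterMeasure_map_apply, PMF.toOuterMeasure_uniformOfFinset_apply, ENNReal.toReal_div, ENNReal.toReal_natCast,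
    ENNReal.toReal_natCast, le_div_iff₀ (by exact_mod_cast hS.card_pos)]
  refine (h k).trans (le_of_eq ?_)
  exact congrArg (fun T : Finset ι => ((T.card : ℕ) : ℝ)) (Finset.filter_congr fun c _ => Iff.rfl)

/-- **The lower bound.** Under the fibre hypotheses of `bornSum_eq_mul_sum_probEvent`, if register
`k` is good for all but a fraction `1/(log₂ N)^f` of the labels meeting `Toff` (every `k`) and the
solver's circuit succeeds with probability `≥ q` on every admissible law, then the Born weight of
"off-block content in `Toff`, solver succeeds" is at least `‖α‖² · #{c : Toff} · q`.
[cite: Regev2004, Lemma 3.12 (proof, p. 14)] -/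
theorem bornSum_ge (hinj : Function.Injective emb)
    (hΨ : ∀ y, Ψ y = if ∃ c, emb c = y then α else 0) (hm : len N + r * (len N + 1) ≤ m)
    (hconst : ∀ c c', Toff (Function.extend E (fun _ => false) (emb c)) →
      Function.extend E (fun _ => false) (emb c') = Function.extend E (fun _ => false) (emb c) → ρf c' = ρf c)
    (hmem : ∀ c c', Toff (Function.extend E (fun _ => false) (emb c)) →
      Function.extend E (fun _ => false) (emb c') = Function.extend E (fun _ => false) (emb c) → DcpSet m N r d (ρf c) (emb c' ∘ E))
    (hsurj : ∀ c u, Toff (Function.extend E (fun _ => false) (emb c)) → DcpSet m N r d (ρf c) u →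
      ∃ c', Function.extend E (fun _ => false) (emb c') = Function.extend E (fun _ => false) (emb c) ∧ emb c' ∘ E = u)
    {f q : ℝ} (hsol : ∀ μ : PMF (Fin r → Register N), IsAdmissible f N μ → q ≤ successProb C N d μ)
    (hgood : ∀ k : Fin r, (1 - 1 / Real.logb 2 N ^ f) * (univ.filter (fun c => Toff (Function.extend E (fun _ => false) (emb c)))).card ≤
      (((univ.filter (fun c => Toff (Function.extend E (fun _ => false) (emb c)))).filter fun c => (ρf c k).1 = none).card : ℝ)) :
    ‖α‖ ^ 2 * (univ.filter (fun c => Toff (Function.extend E (fun _ => false) (emb c)))).card * q ≤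
      ∑ z : QReg W, if Toff (Function.extend E (fun _ => false) z) ∧ z ∘ E ∈ successEvent m N d then
        ‖(placeGate E (C.toMatrix 0) *ᵥ Ψ) z‖ ^ 2 else 0 := by
  classical
  rw [bornSum_eq_mul_sum_probEvent E C Ψ α emb Toff d ρf hinj hΨ hm hconst hmem hsurj]
  set S := univ.filter (fun c => Toff (Function.extend E (fun _ => false) (emb c))) with hSdef
  by_cases hS : S.Nonempty
  · have h1 := hsol _ (isAdmissible_map_uniformOfFinset ρf f S hS hgood)
    rw [successProb_map_uniformOfFinset, le_div_iff₀ (by exact_mod_cast hS.card_pos)] at h1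
    calc ‖α‖ ^ 2 * S.card * q = ‖α‖ ^ 2 * (q * S.card) := by ring
      _ ≤ ‖α‖ ^ 2 * ∑ c ∈ S, C.probEvent 0 (inputState m N r d (ρf c)) (successEvent m N d) :=
        mul_le_mul_of_nonneg_left h1 (by positivity)
  · rw [not_nonempty_iff_eq_empty] at hS
    rw [hS]
    simp

end Mixture

end DCPMixture

end Literature.Computability.QuantumComplexity

end
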